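import Summits.QuantumFields.YangMills.Theorems.CutoffNotchTransportHistoryTailOfNotch
import Summits.QuantumFields.YangMills.Theorems.CutoffNotchTransportHistoryTailOfNotchHRated
import HarnessLib

/-!
# Route `CutoffNotchTransport` — THE GLUE SURVIVES THE RELAXATION `A ↦ A·β_h^{N_A}` OF THE NOTCH CONSTANT
# (`--supports stmt-QuantumFields-26202 --as helper`; seat `ym-line-sfw-p1` g11)

WHY.  The crux `NotchMomentRatioL` (stmt-QuantumFields-26202) asks for a notch constant `A` uniform in the cut-off `K` and the coupling `γ`; at
`j = 0` that is equipartition-grade (evidence `evid-26202-notchZero.md`), while the RELAXED constant `A·β_{K−j}^{N_A}` is what the tree proves at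
`j = 0` (`…NotchZeroPoly`, p617312).  This file shows the relaxation costs the route NOTHING downstream: ★★ `historyTailAt_of_relaxedNotch` —
the relaxed one-notch ratio (spelled out as a hypothesis, `hN`) and `BareCappedMomentL` still give, for every `L`, `b₁`, `p₁`, thresholds
`b₀ = max b₁ 1`, `p₀ = max p₁ 3` and, for every `m ≥ 1`, a `γ₁` with `HistoryTailAt F γ b₀ p₀ m` for all families with `F.L = L` and
`0 < γ ≤ γ₁` — i.e. the conclusion of `HistoryTailOfNotch` VERBATIM.  Ingredients: `notch_iterate_h` (the notch induction with a
HEIGHT-DEPENDENT constant — heights are preserved along the chain), the landed Chernoff step `tail_le_exp_mul_moment`, and the height-polynomial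
bookkeeping `historyTailAt_of_perPlaquette_hrated` (p617650).

HONEST FRAMING.  Nothing here proves the crux (in either form), the registered stubs, or any rung; R3 is a RECORD rung; the YM mass gap is NOT
proved.  No `def`, no `sorry`.

References: T. Bałaban, CMP **102** (1985) 255–275 [Balaban1985UV3] ((7) p.257, (71) p.273); C. King, CMP **102** (1986) 649–677 [King1986] ((3.12) p.657).
-/

set_option autoImplicit false

noncomputable section

open MeasureTheory
open scoped BigOperators

namespace Summit.QuantumFields.YangMills.Theorems.CutoffNotchTransport

open Literature.MathematicalPhysics.QuantumFieldTheory
open Literature.MathematicalPhysics.QuantumFieldTheory.Balaban1983to89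
open Literature.MathematicalPhysics.QuantumFieldTheory.Balaban1983to89.T3ContinuumYM3Torus
open Literature.MathematicalPhysics.QuantumFieldTheory.Balaban1983to89.T3UnitScaleTilt
open Literature.MathematicalPhysics.QuantumFieldTheory.Balaban1983to89.T3UnitLawDensityEML (ℰp)

/-! ## §1 The notch induction with a height-dependent constant -/

section Iterate

variable (F : T3Family) {γ b₀ p₀ : ℝ}

/-- ★ **THE NOTCH INDUCTION, HEIGHT-DEPENDENT CONSTANT**: as `notch_iterate`, with the one-notch constant `A(K − j) ≥ 1` allowed to depend on
the (preserved) height; conclusion `≤ A(K−j)^j·(C·β_{K−j}^N)`. [cite: Balaban1985UV3, (71) p.273] -/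
theorem notch_iterate_h {t₀ t₁ C : ℝ} {N : ℕ} {A : ℕ → ℝ} {ε : ℕ → ℝ} (hε : ∀ i, 0 ≤ ε i) (hA : ∀ h, 1 ≤ A h)
    (hN : ∀ (K j : ℕ), j ≤ K → ∀ (t : ℝ), 0 ≤ t → t ≤ t₀ → ∀ p : Plaq (F.P (K + 1)) (j + 1), ∃ q : Plaq (F.P K) j,
      ∫ U, Real.exp (t * (γ * ((F.L : ℝ)⁻¹) ^ (K - j))⁻¹ *
          min (GaugeGroup.dist1 (GaugeField.plaqHol
            (Averaging.iter (fun i => BlockAveraging.blockAvg (P := F.P (K + 1)) (j := i) ℰp) (j + 1) U) p) ^ 2)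
            (θBal F.L γ b₀ p₀ (K - j) ^ 2)) ∂(gibbsK F ℰp γ (K + 1)) ≤
        A (K - j) * ∫ U, Real.exp ((1 + ε j) * t * (γ * ((F.L : ℝ)⁻¹) ^ (K - j))⁻¹ *
          min (GaugeGroup.dist1 (GaugeField.plaqHol
            (Averaging.iter (fun i => BlockAveraging.blockAvg (P := F.P K) (j := i) ℰp) j U) q) ^ 2)
            (θBal F.L γ b₀ p₀ (K - j) ^ 2)) ∂(gibbsK F ℰp γ K))
    (hB : ∀ (K : ℕ) (t : ℝ), 0 ≤ t → t ≤ t₁ → ∀ q : Plaq (F.P K) 0,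
      ∫ U, Real.exp (t * (γ * ((F.L : ℝ)⁻¹) ^ K)⁻¹ *
          min (GaugeGroup.dist1 (GaugeField.plaqHol U q) ^ 2) (θBal F.L γ b₀ p₀ K ^ 2)) ∂(gibbsK F ℰp γ K) ≤
        C * ((γ * ((F.L : ℝ)⁻¹) ^ K)⁻¹) ^ N) :
    ∀ (j K : ℕ), j ≤ K → ∀ (p : Plaq (F.P K) j) (t : ℝ), 0 ≤ t → t * ∏ i ∈ Finset.range j, (1 + ε i) ≤ min t₀ t₁ →
      ∫ U, Real.exp (t * (γ * ((F.L : ℝ)⁻¹) ^ (K - j))⁻¹ *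
          min (GaugeGroup.dist1 (GaugeField.plaqHol
            (Averaging.iter (fun i => BlockAveraging.blockAvg (P := F.P K) (j := i) ℰp) j U) p) ^ 2)
            (θBal F.L γ b₀ p₀ (K - j) ^ 2)) ∂(gibbsK F ℰp γ K) ≤
        A (K - j) ^ j * (C * ((γ * ((F.L : ℝ)⁻¹) ^ (K - j))⁻¹) ^ N) := by
  intro j
  induction j with
  | zero =>
    intro K _ p t ht htt
    rw [Finset.prod_range_zero, mul_one] at htt
    rw [Nat.sub_zero, pow_zero, one_mul]
    exact hB K t ht (htt.trans (min_le_right _ _)) p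
  | succ j ih =>
    intro K hjK p t ht htt
    obtain ⟨K', rfl⟩ : ∃ K', K = K' + 1 := ⟨K - 1, by omega⟩
    have hj' : j ≤ K' := by omega
    rw [Nat.add_sub_add_right]
    have hP1 : 1 ≤ ∏ i ∈ Finset.range (j + 1), (1 + ε i) := one_le_prod_one_add hε (j + 1)
    have ht₀ : t ≤ t₀ := by
      have : t ≤ t * ∏ i ∈ Finset.range (j + 1), (1 + ε i) := le_mul_of_one_le_right ht hP1
      exact this.trans (htt.trans (min_le_left _ _))
    have htt' : (1 + ε j) * t * ∏ i ∈ Finset.range j, (1 + ε i) ≤ min t₀ t₁ := by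
      rw [Finset.prod_range_succ] at htt
      calc (1 + ε j) * t * ∏ i ∈ Finset.range j, (1 + ε i) = t * ((∏ i ∈ Finset.range j, (1 + ε i)) * (1 + ε j)) := by ring
        _ ≤ min t₀ t₁ := htt
    have ht' : 0 ≤ (1 + ε j) * t := mul_nonneg (by linarith [hε j]) ht
    obtain ⟨q, hq⟩ := hN K' j hj' t ht ht₀ p
    have hih := ih K' hj' q ((1 + ε j) * t) ht' htt'
    have hA0 : 0 ≤ A (K' - j) := zero_le_one.trans (hA _)
    calc _ ≤ A (K' - j) * ∫ U, Real.exp ((1 + ε j) * t * (γ * ((F.L : ℝ)⁻¹) ^ (K' - j))⁻¹ *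
          min (GaugeGroup.dist1 (GaugeField.plaqHol
            (Averaging.iter (fun i => BlockAveraging.blockAvg (P := F.P K') (j := i) ℰp) j U) q) ^ 2)
            (θBal F.L γ b₀ p₀ (K' - j) ^ 2)) ∂(gibbsK F ℰp γ K') := hq
      _ ≤ A (K' - j) * (A (K' - j) ^ j * (C * ((γ * ((F.L : ℝ)⁻¹) ^ (K' - j))⁻¹) ^ N)) := mul_le_mul_of_nonneg_left hih hA0
      _ = A (K' - j) ^ (j + 1) * (C * ((γ * ((F.L : ℝ)⁻¹) ^ (K' - j))⁻¹) ^ N) := by rw [pow_succ]; ring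

end Iterate

/-! ## §2 The glue from the RELAXED notch -/

/-- ★★ **`HistoryTailOfNotch`'S CONCLUSION FROM THE RELAXED NOTCH**: if the one-notch moment ratio holds with constant `A·β_{K−j}^{N_A}`
(`A ≥ 1`, `N_A : ℕ`; hypothesis `hN`, the relaxed crux spelled out) and `BareCappedMomentL` holds, then for every `L b₁ p₁` the thresholds
`(max b₁ 1, max p₁ 3)` serve and for every `m ≥ 1` some `γ₁ > 0` gives `HistoryTailAt F γ (max b₁ 1) (max p₁ 3) m` for all families with
`F.L = L`, `0 < γ ≤ γ₁` — the chain's loss `(A·β_h^{N_A})^j = A^j·(β_h^{N_A})^j` is absorbed by `historyTailAt_of_perPlaquette_hrated`.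
[cite: Balaban1985UV3, (71) p.273; King1986, (3.12) p.657] -/
theorem historyTailAt_of_relaxedNotch
    (hN : ∀ (L : ℕ) (b₀ p₀ : ℝ), 0 < b₀ → 2 < p₀ → ∃ (γ₁ t₀ A E : ℝ) (NA : ℕ) (ε : ℕ → ℝ), 0 < γ₁ ∧ γ₁ ≤ 1 ∧ 0 < t₀ ∧ 1 ≤ A ∧
      (∀ i, 0 ≤ ε i) ∧ (∀ n, ∏ i ∈ Finset.range n, (1 + ε i) ≤ E) ∧
      ∀ (F : T3Family) (γ : ℝ), F.L = L → 0 < γ → γ ≤ γ₁ → ∀ (K j : ℕ), j ≤ K → ∀ (t : ℝ), 0 ≤ t → t ≤ t₀ →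
        ∀ p : Plaq (F.P (K + 1)) (j + 1), ∃ q : Plaq (F.P K) j,
          ∫ U, Real.exp (t * (γ * ((F.L : ℝ)⁻¹) ^ (K - j))⁻¹ *
              min (GaugeGroup.dist1 (GaugeField.plaqHol
                (Averaging.iter (fun i => BlockAveraging.blockAvg (P := F.P (K + 1)) (j := i) ℰp) (j + 1) U) p) ^ 2)
                (θBal F.L γ b₀ p₀ (K - j) ^ 2)) ∂(gibbsK F ℰp γ (K + 1)) ≤
            A * ((γ * ((F.L : ℝ)⁻¹) ^ (K - j))⁻¹) ^ NA *
              ∫ U, Real.exp ((1 + ε j) * t * (γ * ((F.L : ℝ)⁻¹) ^ (K - j))⁻¹ *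
                min (GaugeGroup.dist1 (GaugeField.plaqHol
                  (Averaging.iter (fun i => BlockAveraging.blockAvg (P := F.P K) (j := i) ℰp) j U) q) ^ 2)
                  (θBal F.L γ b₀ p₀ (K - j) ^ 2)) ∂(gibbsK F ℰp γ K))
    (hB : Summit.QuantumFields.YangMills.Theses.CutoffNotchTransport.BareCappedMomentL) :
    ∀ (L : ℕ) (b₁ p₁ : ℝ), ∃ (b₀ p₀ : ℝ), b₁ ≤ b₀ ∧ p₁ ≤ p₀ ∧ 0 < b₀ ∧ 2 < p₀ ∧ ∀ (m : ℕ), 0 < m →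
      ∃ γ₁ : ℝ, 0 < γ₁ ∧ ∀ (F : T3Family) (γ : ℝ), F.L = L → 0 < γ → γ ≤ γ₁ → HistoryTailAt F γ b₀ p₀ m := by
  intro L b₁ p₁
  have hb₀ : (0 : ℝ) < max b₁ 1 := lt_of_lt_of_le one_pos (le_max_right _ _)
  have hp₀ : (2 : ℝ) < max p₁ 3 := lt_of_lt_of_le (by norm_num) (le_max_right _ _)
  have hp₀2 : (2 : ℝ) ≤ max p₁ 3 := hp₀.le
  refine ⟨max b₁ 1, max p₁ 3, le_max_left _ _, le_max_left _ _, hb₀, hp₀, ?_⟩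
  intro m hm
  obtain ⟨γN, t₀, A, E, NA, ε, hγN, hγN1, ht₀, hA1, hε, hE, hNotch⟩ := hN L (max b₁ 1) (max p₁ 3) hb₀ hp₀
  obtain ⟨t₁, CB, NB, ht₁, hBase⟩ := hB
  refine ⟨γN, hγN, ?_⟩
  intro F γ hFL hγ hγ₁
  have hγ1 : γ ≤ 1 := hγ₁.trans hγN1
  have hL0 : (0 : ℝ) < F.L := by exact_mod_cast lt_trans zero_lt_one F.hL.2
  have hE1 : 1 ≤ E := by simpa using hE 0
  have hE0 : 0 < E := one_pos.trans_le hE1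
  set ts : ℝ := min t₀ t₁ / E with hts
  have hts0 : 0 < ts := div_pos (lt_min ht₀ ht₁) hE0
  have htsE : ∀ j : ℕ, ts * ∏ i ∈ Finset.range j, (1 + ε i) ≤ min t₀ t₁ := by
    intro j
    calc ts * ∏ i ∈ Finset.range j, (1 + ε i) ≤ ts * E := mul_le_mul_of_nonneg_left (hE j) hts0.le
      _ = min t₀ t₁ := by rw [hts]; field_simp
  -- the height-dependent notch constant `A·β_h^{N_A} ≥ 1`
  have hβ1 : ∀ h : ℕ, 1 ≤ (γ * ((F.L : ℝ)⁻¹) ^ h)⁻¹ := fun h => by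
    have hx : 0 < γ * ((F.L : ℝ)⁻¹) ^ h := mul_pos hγ (pow_pos (inv_pos.mpr hL0) h)
    refine (one_le_inv₀ hx).mpr ?_
    exact mul_le_one₀ hγ1 (pow_nonneg (inv_nonneg.mpr hL0.le) h)
      (pow_le_one₀ (inv_nonneg.mpr hL0.le) (inv_le_one_of_one_le₀ (by exact_mod_cast le_of_lt F.hL.2)))
  have hAh : ∀ h : ℕ, 1 ≤ A * (γ * ((F.L : ℝ)⁻¹) ^ h)⁻¹ ^ NA := fun h =>
    one_le_mul_of_one_le_of_one_le hA1 (one_le_pow₀ (hβ1 h))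
  refine historyTailAt_of_perPlaquette_hrated F hγ hγ1 hb₀ hp₀2 hm (C := max CB 0) (R := A) (A := NB) (B := NA) (c := ts)
    (le_max_right _ _) hA1 hts0 ?_
  intro K j hjK p
  have hiter := notch_iterate_h F hε hAh (fun K j hjK t ht ht0 p => hNotch F γ hFL hγ hγ₁ K j hjK t ht ht0 p)
    (fun K t ht ht1 q => hBase F γ (max b₁ 1) (max p₁ 3) hγ hγ1 hb₀ K t ht ht1 q) j K hjK p ts hts0.le (htsE j)
  have hcher := tail_le_exp_mul_moment F hγ hγ1 hb₀ (max p₁ 3) K j p hts0.le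
  have hA0 : 0 ≤ A ^ j := pow_nonneg (zero_le_one.trans hA1) j
  have hβ0 : 0 ≤ (γ * ((F.L : ℝ)⁻¹) ^ (K - j))⁻¹ ^ NB := by positivity
  have hβB0 : 0 ≤ ((γ * ((F.L : ℝ)⁻¹) ^ (K - j))⁻¹ ^ NA) ^ j := by positivity
  have hexp0 : 0 ≤ Real.exp (-(ts * B10.pFun (max b₁ 1) (max p₁ 3) (Real.sqrt (γ * ((F.L : ℝ)⁻¹) ^ (K - j))) ^ 2)) :=
    (Real.exp_pos _).le
  refine hcher.trans ?_
  refine (mul_le_mul_of_nonneg_left hiter hexp0).trans ?_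
  have hCB : CB * (γ * ((F.L : ℝ)⁻¹) ^ (K - j))⁻¹ ^ NB ≤ max CB 0 * (γ * ((F.L : ℝ)⁻¹) ^ (K - j))⁻¹ ^ NB :=
    mul_le_mul_of_nonneg_right (le_max_left _ _) hβ0
  rw [mul_pow]
  calc Real.exp (-(ts * B10.pFun (max b₁ 1) (max p₁ 3) (Real.sqrt (γ * ((F.L : ℝ)⁻¹) ^ (K - j))) ^ 2)) *
        (A ^ j * ((γ * ((F.L : ℝ)⁻¹) ^ (K - j))⁻¹ ^ NA) ^ j * (CB * (γ * ((F.L : ℝ)⁻¹) ^ (K - j))⁻¹ ^ NB))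
      ≤ Real.exp (-(ts * B10.pFun (max b₁ 1) (max p₁ 3) (Real.sqrt (γ * ((F.L : ℝ)⁻¹) ^ (K - j))) ^ 2)) *
        (A ^ j * ((γ * ((F.L : ℝ)⁻¹) ^ (K - j))⁻¹ ^ NA) ^ j * (max CB 0 * (γ * ((F.L : ℝ)⁻¹) ^ (K - j))⁻¹ ^ NB)) :=
        mul_le_mul_of_nonneg_left (mul_le_mul_of_nonneg_left hCB (mul_nonneg hA0 hβB0)) hexp0
    _ = max CB 0 * A ^ j * (γ * ((F.L : ℝ)⁻¹) ^ (K - j))⁻¹ ^ NB * ((γ * ((F.L : ℝ)⁻¹) ^ (K - j))⁻¹ ^ NA) ^ j *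
        Real.exp (-(ts * B10.pFun (max b₁ 1) (max p₁ 3) (Real.sqrt (γ * ((F.L : ℝ)⁻¹) ^ (K - j))) ^ 2)) := by ring

end Summit.QuantumFields.YangMills.Theorems.CutoffNotchTransport

end
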